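import Summits.ValiantsHypothesis.ValiantsHypothesis.Theses.GeneratorObstructions
import Summits.ValiantsHypothesis.ValiantsHypothesis.Theorems.GeneratorObstructionsCruxesToThesis
import Summits.ValiantsHypothesis.ValiantsHypothesis.Theorems.GeneratorObstructionsGenInheritance

/-!
# ValiantsHypothesis / GeneratorObstructions — item `GenFlipThesisOfSubs` (stmt-ValiantsHypothesis-18306), closed

Glue of the typed split of the deciding crux of route `GeneratorObstructions` (Gesmundo–Ikenmeyer–Panova
2017 generator obstructions for power traces versus the permanent): `PerGenDegreeSuperQP → PowGenDegreeQP →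
GenFlipThesis`. It is the PROVED support item `CruxesToThesis`
(`Theorems.GeneratorObstructions.cruxesToThesis_proof`, stmt-11662:
`PerGenDegreeSuperQP → PowGenDegreeQP → GenInheritance → GenFlipThesis`) with its third hypothesis
discharged by the PROVED inheritance item `GenInheritance` (`Theorems.genInheritance_proof`, stmt-11659).
One term, as recorded on the item by the route's refuter review (2026-08-17: "GenFlipThesisOfSubs =
cruxesToThesis_proof ∘ genInheritance_proof"). HONEST FRAMING: bookkeeping; both remaining hypotheses
(`PerGenDegreeSuperQP`, `PowGenDegreeQP`) are OPEN cruxes; nothing here is progress on `VP ≠ VNP`.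
-/

-- layout Summits/ValiantsHypothesis/ValiantsHypothesis forces the duplicated namespace component
set_option linter.dupNamespace false

namespace Summit.ValiantsHypothesis.ValiantsHypothesis.Theorems.GeneratorObstructions

/-- **Item `GenFlipThesisOfSubs` (stmt-ValiantsHypothesis-18306):** `PerGenDegreeSuperQP → PowGenDegreeQP →
GenFlipThesis`, by `cruxesToThesis_proof` fed with `genInheritance_proof`. [folklore] -/
theorem genFlipThesisOfSubs_proof : Theses.GeneratorObstructions.GenFlipThesisOfSubs := by
  unfold Theses.GeneratorObstructions.GenFlipThesisOfSubs
  exact fun hK1 hK2 => cruxesToThesis_proof hK1 hK2 genInheritance_proof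

end Summit.ValiantsHypothesis.ValiantsHypothesis.Theorems.GeneratorObstructions
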